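import Summits.CriticalPhenomena.PercolationContinuityZ3.Theorems.PercNearOneGluingNoHeavyLowerTailSahiThreeCopyTwoPointFast
import Summits.CriticalPhenomena.PercolationContinuityZ3.Theorems.PercNearOneGluingNoHeavyLowerTailSahiThreeCopyTwoPointCertsK4Data
import Mathlib.Data.Fintype.Perm

/-!
# Sahi's three-function conjecture — 3C for every triple whose first slot depends on at most four coordinates

The `k = 4` certificate theorem (companion of `…TwoPointCerts` for `k = 3`, `…TwoPointFast` for the checker/bridge/relabelling,
`…TwoPointCertsK4Data` for the table `certTable4` of `2701` LP-generated sandwich certificates, one per `S₄`-orbit of pairs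
`(f, π)`, `f ⊆ {0,1}^4` an up-set, `π ∈ {0,1,2,3}^4`).

* §3 An optimised exact check `certOKfast2`: the `(N1)` kernel is DIAGONAL (`N1C_single_off`), so `(N1)` needs one bitmask sum
  per up-set; `(N2)` exits early on entrywise-nonnegative rows; `facts_of_certOKfast2` recovers the rational facts.
* §4 Decoding the table, the orbit table (`2701 × 24` keys) with VALIDATED lookup (`findRep4_spec` — no property of the search is
  needed), the evaluations `coverAll4_true` (every `(π, F)` has a representative) and `checkChunk4_0 … checkChunk4_5` (every
  certificate passes; integer arithmetic, `native_decide`, six chunks of ≈ 450 entries, ≈ 1 min each), and the theorem: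
  ★★★ `tc_front4_nonneg`: `0 ≤ c_{(π,b)}(1_A ∘ front, G, H)` for EVERY up-set `A ⊆ {0,1}^4`, every profile, every back cube
  `{0,1}^d` and all nonnegative monotone `G, H`; `sahiE_three_coin_front4_nonneg`: Kahn's `E₃ ≥ 0` for product measures and
  every triple whose first function depends on at most four coordinates.
* `d = 0` corollaries (3C-SAHI for ALL nonnegative monotone triples on `{0,1}^4`, Sahi's `C₃` for every product measure on four bits)
  are in `…SahiThreeCopyFourCube`.
-/

namespace Summit.CriticalPhenomena.PercolationContinuityZ3.Theorems.SahiThreeCopy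

open Finset Function Literature.Combinatorics.Sahi2008
open scoped BigOperators

/-! ### §3 An optimised check: (N1) is diagonal, early exit on nonnegative rows -/

section Fast2

variable {k : ℕ}

/-- `r[i] ≥ 0` for all `i < n` (a loop). [this work] -/
def allNonneg (r : Array ℤ) : ℕ → Bool
  | 0 => true
  | i + 1 => allNonneg r i && decide (0 ≤ r.getD i 0)

/-- Specification of `allNonneg`. [this work] -/
theorem allNonneg_getD {r : Array ℤ} : ∀ {n : ℕ}, allNonneg r n = true → ∀ i < n, 0 ≤ r.getD i 0
  | 0, _, i, hi => absurd hi (Nat.not_lt_zero i)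
  | n + 1, h, i, hi => by
    rw [allNonneg, Bool.and_eq_true, decide_eq_true_eq] at h
    rcases Nat.lt_succ_iff_lt_or_eq.1 hi with hlt | rfl
    · exact allNonneg_getD h.1 i hlt
    · exact h.2

/-- The diagonal of the `(N1)` kernel (the kernel IS diagonal, see `N1C_single_off`). [this work] -/
def diag1 (S : ℕ) (A : Finset (Fin (2 ^ k) × Fin (2 ^ k) × Fin (2 ^ k))) (F : Finset (Fin (2 ^ k))) (tab : Array ℤ) : Array ℤ :=
  Array.ofFn fun x : Fin (2 ^ k) => N1Z S A F tab {x} {x}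

/-- Inner `(N2)` check for one `V`, with early exit when the row is entrywise nonnegative. [this work] -/
def rowOK2 (K2 : Vector (Vector ℤ (2 ^ k)) (2 ^ k)) (UM : Finset ℕ) (V : Finset (Fin (2 ^ k))) : Bool :=
  let r := rowSum K2 V
  allNonneg r (2 ^ k) || allMem UM fun m => decide (0 ≤ sumBits r m (2 ^ k))

/-- The optimised certificate check (scale `S`; `UM` = the masks of `U`). [this work] -/
def certOKfast2 (S : ℕ) (A : Finset (Fin (2 ^ k) × Fin (2 ^ k) × Fin (2 ^ k))) (U : Finset (Finset (Fin (2 ^ k))))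
    (UM : Finset ℕ) (F : Finset (Fin (2 ^ k))) (tab : Array ℤ) : Bool :=
  let d1 := diag1 S A F tab
  let K2 := kmat2 S A F tab
  decide (∀ x : Fin (2 ^ k), 0 ≤ thetaZ tab x) && (allMem UM fun m => decide (0 ≤ sumBits d1 m (2 ^ k))) &&
    allMem U fun V => rowOK2 K2 UM V

/-- The `(N1)` kernel vanishes off the diagonal. [this work] -/
theorem N1C_single_off (A : Finset (Fin (2 ^ k) × Fin (2 ^ k) × Fin (2 ^ k))) (F : Finset (Fin (2 ^ k))) (tab : Array ℚ)
    {x y : Fin (2 ^ k)} (hxy : x ≠ y) : N1C A F tab {x} {y} = 0 := by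
  unfold N1C
  refine Finset.sum_eq_zero fun σ _ => ?_
  have h0 : ∀ z : Fin (2 ^ k), mC {x} z * mC {y} z = 0 := by
    intro z
    unfold mC
    simp only [Finset.mem_singleton]
    by_cases hx : z = x
    · subst hx; rw [if_neg hxy]; ring
    · rw [if_neg hx]; ring
  rw [h0, h0]; ring

/-- Hence `(N1)` at `(V, W)` is the diagonal sum over `V ∩ W`. [this work] -/
theorem N1C_eq_sum_inter (A : Finset (Fin (2 ^ k) × Fin (2 ^ k) × Fin (2 ^ k))) (F : Finset (Fin (2 ^ k))) (tab : Array ℚ)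
    (V W : Finset (Fin (2 ^ k))) : N1C A F tab V W = ∑ x ∈ V ∩ W, N1C A F tab {x} {x} := by
  rw [N1C_eq_sum_singleton, ← Finset.sum_ite_mem]
  refine Finset.sum_congr rfl fun x _ => ?_
  by_cases hx : x ∈ W
  · rw [if_pos hx, Finset.sum_eq_single_of_mem x hx (fun y _ hyx => N1C_single_off A F tab (Ne.symm hyx))]
  · rw [if_neg hx]
    exact Finset.sum_eq_zero fun y hy => N1C_single_off A F tab (fun hxy => hx (hxy ▸ hy))

/-- Up-closed families of codes are closed under intersection. [this work] -/
theorem inter_mem_upSetsC {V W : Finset (Fin (2 ^ k))} (hV : V ∈ upSetsC k) (hW : W ∈ upSetsC k) : V ∩ W ∈ upSetsC k := by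
  simp only [upSetsC, Finset.mem_filter, Finset.mem_univ, true_and] at hV hW ⊢
  intro x hx y hxy
  rw [Finset.mem_inter] at hx ⊢
  exact ⟨hV x hx.1 y hxy, hW x hx.2 y hxy⟩

/-- Reading the diagonal. [this work] -/
theorem diag1_getD (S : ℕ) (A : Finset (Fin (2 ^ k) × Fin (2 ^ k) × Fin (2 ^ k))) (F : Finset (Fin (2 ^ k))) (tab : Array ℤ)
    (x : Fin (2 ^ k)) : (diag1 S A F tab).getD (x : ℕ) 0 = N1Z S A F tab {x} {x} := by
  unfold diag1
  have hx : (x : ℕ) < (Array.ofFn fun x : Fin (2 ^ k) => N1Z S A F tab {x} {x}).size := by rw [Array.size_ofFn]; exact x.isLt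
  rw [Array.getD_eq_getD_getElem?, Array.getElem?_eq_getElem hx, Option.getD_some, Array.getElem_ofFn]

/-- ★ Unpacking the optimised check into the rational facts. [this work] -/
theorem facts_of_certOKfast2 {S : ℕ} (hS : 0 < S) {A : Finset (Fin (2 ^ k) × Fin (2 ^ k) × Fin (2 ^ k))}
    {U : Finset (Finset (Fin (2 ^ k)))} (hU : ∀ V ∈ U, ∀ W ∈ U, V ∩ W ∈ U) {F : Finset (Fin (2 ^ k))} {tab : Array ℤ}
    (h : certOKfast2 S A U (U.image maskOf) F tab = true) :
    (∀ x : Fin (2 ^ k), 0 ≤ thetaC (tabQof S k tab) x) ∧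
      (∀ V ∈ U, ∀ W ∈ U, 0 ≤ N1C A F (tabQof S k tab) V W ∧ 0 ≤ N2C A F (tabQof S k tab) V W) := by
  unfold certOKfast2 at h
  rw [Bool.and_eq_true, Bool.and_eq_true, decide_eq_true_eq, allMem_eq_true, allMem_eq_true] at h
  obtain ⟨⟨hθ, hd⟩, hr⟩ := h
  have hSq : (0 : ℚ) < S := by exact_mod_cast hS
  refine ⟨fun x => ?_, fun V hV W hW => ⟨?_, ?_⟩⟩
  · rw [thetaC_tabQof]; exact div_nonneg (by exact_mod_cast hθ x) hSq.le
  · -- (N1): diagonal sum over `V ∩ W`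
    have h1 := hd (maskOf (V ∩ W)) (Finset.mem_image_of_mem _ (hU V hV W hW))
    rw [decide_eq_true_eq, sumBits_maskOf] at h1
    simp only [diag1_getD] at h1
    have h1c : (0 : ℚ) ≤ ((∑ x ∈ V ∩ W, N1Z S A F tab {x} {x} : ℤ) : ℚ) := by exact_mod_cast h1
    rw [Int.cast_sum] at h1c
    have h1' : (0 : ℚ) ≤ S * N1C A F (tabQof S k tab) V W := by
      rw [N1C_eq_sum_inter, Finset.mul_sum]
      refine h1c.trans_eq (Finset.sum_congr rfl fun x _ => cast_N1Z hS A F tab {x} {x})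
    exact (mul_nonneg_iff_of_pos_left hSq).1 h1'
  · -- (N2): row sums, with the early exit
    have hrV := hr V hV
    unfold rowOK2 at hrV
    rw [Bool.or_eq_true, allMem_eq_true] at hrV
    have h2 : 0 ≤ ∑ y ∈ W, (rowSum (kmat2 S A F tab) V).getD (y : ℕ) 0 := by
      rcases hrV with hnn | hall
      · exact Finset.sum_nonneg fun y _ => allNonneg_getD hnn y y.isLt
      · have := hall (maskOf W) (Finset.mem_image_of_mem _ hW)
        rwa [decide_eq_true_eq, sumBits_maskOf] at this
    simp only [rowSum_getD, kmat2, Fin.getElem_fin, Vector.getElem_ofFn, Fin.eta] at h2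
    have h2c : (0 : ℚ) ≤ ((∑ y ∈ W, ∑ x ∈ V, N2Z S A F tab {x} {y} : ℤ) : ℚ) := by exact_mod_cast h2
    rw [Int.cast_sum] at h2c
    have h2' : (0 : ℚ) ≤ S * N2C A F (tabQof S k tab) V W := by
      rw [N2C_eq_sum_singleton, Finset.sum_comm, Finset.mul_sum]
      refine h2c.trans_eq (Finset.sum_congr rfl fun y _ => ?_)
      rw [Int.cast_sum, Finset.mul_sum]
      exact Finset.sum_congr rfl fun x _ => cast_N2Z hS A F tab {x} {y}
    exact (mul_nonneg_iff_of_pos_left hSq).1 h2'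

end Fast2

/-! ### §4 The data side at `k = 4`: decoding `certTable4`, the orbit table, the checks, and the theorem -/

section K4

/-- `S₄` as a list of permutations (data). [this work] -/
def perms4 : List (Equiv.Perm (Fin 4)) := permsOfList (List.finRange 4)

/-- The up-set (family of codes) with bitmask `fm` (decoding a table entry). [this work] -/
def setOfMask (fm : ℕ) : Finset (Fin (2 ^ 4)) := univ.filter fun y => fm.testBit y

/-- The profile with base-4 code `pc` (decoding a table entry). [this work] -/
def profOfCode (pc : ℕ) : Fin 4 → ℕ := fun i => pc / 4 ^ (i : ℕ) % 4

/-- Base-4 code of a profile. [this work] -/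
def profCode (π : Fin 4 → ℕ) : ℕ := ∑ i : Fin 4, π i * 4 ^ (i : ℕ)

/-- Entry `j` of `certTable4` (`(fmask, profile code, packed conv)`; default past the end). [this work] -/
def entry4 (j : ℕ) : ℕ × ℕ × ℕ := certTable4.getD j (0, 0, 0)

/-- Digit `e` (base 32) of a packed `conv` vector. [this work] -/
def convDigit (cc e : ℕ) : ℕ := cc / 32 ^ e % 32

/-- Multiplicity of a first-block level among the arrangements. [this work] -/
def multC (A : Finset (Fin (2 ^ 4) × Fin (2 ^ 4) × Fin (2 ^ 4))) (e : Fin (2 ^ 4)) : ℕ := (A.filter fun σ => σ.1 = e).card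

/-- The integer weight table `16·θ`, `θ_e = conv_e / mult(e)`, of a packed `conv` vector. [this work] -/
def tabOfConv (cc : ℕ) (A : Finset (Fin (2 ^ 4) × Fin (2 ^ 4) × Fin (2 ^ 4))) : Array ℤ :=
  Array.ofFn fun e : Fin (2 ^ 4) => ((convDigit cc e * (16 / multC A e) : ℕ) : ℤ)

/-- The arrangement sets of all `256` profile codes (computed once). [this work] -/
def arrTab4 : Array (Finset (Fin (2 ^ 4) × Fin (2 ^ 4) × Fin (2 ^ 4))) := Array.ofFn fun c : Fin 256 => arrSetC (profOfCode c)

/-- The check of table entry `j`. [this work] -/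
def checkEntry4 (U : Finset (Finset (Fin (2 ^ 4)))) (UM : Finset ℕ) (AT : Array (Finset (Fin (2 ^ 4) × Fin (2 ^ 4) × Fin (2 ^ 4))))
    (j : ℕ) : Bool :=
  decide ((entry4 j).2.1 < 256) &&
    certOKfast2 16 (AT.getD (entry4 j).2.1 ∅) U UM (setOfMask (entry4 j).1) (tabOfConv (entry4 j).2.2 (AT.getD (entry4 j).2.1 ∅))

/-- Reading the precomputed arrangement sets. [this work] -/
theorem arrTab4_getD {c : ℕ} (hc : c < 256) : arrTab4.getD c ∅ = arrSetC (profOfCode c) := by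
  unfold arrTab4
  rw [Array.getD_eq_getD_getElem?, Array.getElem?_eq_getElem (by rw [Array.size_ofFn]; exact hc), Option.getD_some,
    Array.getElem_ofFn]

/-- Search key of a pair `(π, F)`. [this work] -/
def key4 (π : Fin 4 → ℕ) (F : Finset (Fin (2 ^ 4))) : ℕ := maskOf F * 256 + profCode π

/-- The orbit table: for every entry `j` and `σ ∈ S₄`, the key of `σ·(entry j)` together with `(j, σ)`, sorted by key. [this work] -/
def orbitTab4 : Array (ℕ × ℕ × Equiv.Perm (Fin 4)) :=
  ((List.range certTable4.size).flatMap fun j =>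
    perms4.map fun σ : Equiv.Perm (Fin 4) =>
      (key4 (profOfCode (entry4 j).2.1 ∘ ⇑σ) ((setOfMask (entry4 j).1).image (permCode ⇑σ)), j, σ)).toArray.qsort
    fun a b => a.1 < b.1

/-- Binary search in the orbit table (an index carrying the key, if any; fuelled). [this work] -/
def bsearchOT (OT : Array (ℕ × ℕ × Equiv.Perm (Fin 4))) (key : ℕ) : ℕ → ℕ → ℕ → Option ℕ
  | 0, _, _ => none
  | fuel + 1, a, b =>
    if b ≤ a then none
    else if (OT.getD ((a + b) / 2) (0, 0, 1)).1 = key then some ((a + b) / 2)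
    else if (OT.getD ((a + b) / 2) (0, 0, 1)).1 < key then bsearchOT OT key fuel ((a + b) / 2 + 1) b
    else bsearchOT OT key fuel a ((a + b) / 2)

/-- Validation of a candidate `(key, j, σ)` against `(π, F)`: `j` a valid index, `F = σ·F₀(j)`, `π = π₀(j) ∘ σ`. [this work] -/
def validate4 (t : ℕ × ℕ × Equiv.Perm (Fin 4)) (π : Fin 4 → ℕ) (F : Finset (Fin (2 ^ 4))) : Option (ℕ × Equiv.Perm (Fin 4)) :=
  if t.2.1 < certTable4.size ∧ F = (setOfMask (entry4 t.2.1).1).image (permCode ⇑t.2.2) ∧ π = profOfCode (entry4 t.2.1).2.1 ∘ ⇑t.2.2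
  then some (t.2.1, t.2.2) else none

/-- Locate a representative of `(π, F)` (searched by key, then VALIDATED — no property of the search is ever needed). [this work] -/
def findRep4 (OT : Array (ℕ × ℕ × Equiv.Perm (Fin 4))) (π : Fin 4 → ℕ) (F : Finset (Fin (2 ^ 4))) : Option (ℕ × Equiv.Perm (Fin 4)) :=
  match bsearchOT OT (key4 π F) 64 0 OT.size with
  | none => none
  | some i => validate4 (OT.getD i (0, 0, 1)) π F

/-- What a successful `findRep4` guarantees. [this work] -/
theorem findRep4_spec {OT : Array (ℕ × ℕ × Equiv.Perm (Fin 4))} {π : Fin 4 → ℕ} {F : Finset (Fin (2 ^ 4))} {j : ℕ}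
    {σ : Equiv.Perm (Fin 4)} (h : findRep4 OT π F = some (j, σ)) :
    j < certTable4.size ∧ F = (setOfMask (entry4 j).1).image (permCode ⇑σ) ∧ π = profOfCode (entry4 j).2.1 ∘ ⇑σ := by
  unfold findRep4 at h
  split at h
  · exact absurd h (by simp)
  · unfold validate4 at h
    split_ifs at h with hc
    simp only [Option.some.injEq, Prod.mk.injEq] at h
    obtain ⟨rfl, rfl⟩ := h
    exact hc

/-- The cover check, parametrised by `(U, OT)`: every `(π, F)`, `π ∈ {0,1,2,3}^4`, `F ∈ U`, has a validated representative. [this work] -/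
def coverWith (U : Finset (Finset (Fin (2 ^ 4)))) (OT : Array (ℕ × ℕ × Equiv.Perm (Fin 4))) : Bool :=
  decide (∀ π : Fin 4 → Fin 4, allMem U (fun F => decide (F = ∅) || (findRep4 OT (fun i => (π i : ℕ)) F).isSome) = true)

/-- Unpacking `coverWith`: a representative `(j, σ)` for every `(π, F)`, `F ≠ ∅` (the table omits the empty up-set). [this work] -/
theorem rep_of_coverWith {U : Finset (Finset (Fin (2 ^ 4)))} {OT : Array (ℕ × ℕ × Equiv.Perm (Fin 4))}
    (h : coverWith U OT = true) (π : Fin 4 → Fin 4) {F : Finset (Fin (2 ^ 4))} (hF : F ∈ U) (hne : F ≠ ∅) :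
    ∃ (j : ℕ) (σ : Equiv.Perm (Fin 4)), j < certTable4.size ∧ F = (setOfMask (entry4 j).1).image (permCode ⇑σ) ∧
      (fun i => (π i : ℕ)) = profOfCode (entry4 j).2.1 ∘ ⇑σ := by
  unfold coverWith at h
  rw [decide_eq_true_eq] at h
  have h1 := (allMem_eq_true.1 (h π)) F hF
  rw [Bool.or_eq_true, decide_eq_true_eq] at h1
  rcases h1 with h1 | h1
  · exact absurd h1 hne
  rw [Option.isSome_iff_exists] at h1
  obtain ⟨⟨j, σ⟩, hfind⟩ := h1
  exact ⟨j, σ, findRep4_spec hfind⟩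

/-- The empty first slot: `frontFn k 1_∅ = 0`, so the coefficient is `≥ 0` (indeed `0`) — via the reduction theorem with `θ = 0`. [this work] -/
theorem tc_frontFn_setInd_empty_nonneg {k : ℕ} (π : Fin k → ℕ) {d : ℕ} (b : Fin d → ℕ) {G H : Pt (d + k) → ℝ}
    (hG : ∀ w, 0 ≤ G w) (hH : ∀ w, 0 ≤ H w) (hGm : Monotone G) (hHm : Monotone H) :
    0 ≤ tc (appendProf k π b) (frontFn k (setInd (∅ : Finset (Pt k)))) G H := by
  refine tc_frontFn_nonneg_of_upSets k π _ (fun _ _ _ => 0) (fun _ _ _ => le_rfl) ?_ ?_ b hG hH hGm hHm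
  · intro V W _ _
    simp [N1form, setInd]
  · intro V W _ _
    simp [N2form, setInd]

/-- ★ The cover check passes (by evaluation): every `(π, F)` has a representative in `certTable4` up to `S₄`. [this work] -/
theorem coverAll4_true : coverWith (upSetsC 4) orbitTab4 = true := by
  native_decide

/-- A chunk of the certificate check: entries `a ≤ j < a + n`. [this work] -/
def checkChunk (U : Finset (Finset (Fin (2 ^ 4)))) (UM : Finset ℕ) (AT : Array (Finset (Fin (2 ^ 4) × Fin (2 ^ 4) × Fin (2 ^ 4))))
    (a n : ℕ) : Bool :=
  (List.range' a n).all fun j => checkEntry4 U UM AT j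

/-- Unpacking a chunk. [this work] -/
theorem checkEntry4_of_chunk {U : Finset (Finset (Fin (2 ^ 4)))} {UM : Finset ℕ}
    {AT : Array (Finset (Fin (2 ^ 4) × Fin (2 ^ 4) × Fin (2 ^ 4)))} {a n : ℕ} (h : checkChunk U UM AT a n = true) {j : ℕ}
    (h1 : a ≤ j) (h2 : j < a + n) : checkEntry4 U UM AT j = true := by
  unfold checkChunk at h
  rw [List.all_eq_true] at h
  exact h j (List.mem_range'_1.2 ⟨h1, h2⟩)

/-- ★★ The certificates of `certTable4` pass the exact check — entries 0–449 (by evaluation, integer arithmetic). [this work] -/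
theorem checkChunk4_0 : checkChunk (upSetsC 4) ((upSetsC 4).image maskOf) arrTab4 0 450 = true := by
  native_decide

/-- … entries 450–899. [this work] -/
theorem checkChunk4_1 : checkChunk (upSetsC 4) ((upSetsC 4).image maskOf) arrTab4 450 450 = true := by
  native_decide

/-- … entries 900–1349. [this work] -/
theorem checkChunk4_2 : checkChunk (upSetsC 4) ((upSetsC 4).image maskOf) arrTab4 900 450 = true := by
  native_decide

/-- … entries 1350–1799. [this work] -/
theorem checkChunk4_3 : checkChunk (upSetsC 4) ((upSetsC 4).image maskOf) arrTab4 1350 450 = true := by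
  native_decide

/-- … entries 1800–2249. [this work] -/
theorem checkChunk4_4 : checkChunk (upSetsC 4) ((upSetsC 4).image maskOf) arrTab4 1800 450 = true := by
  native_decide

/-- … entries 2250–2700. [this work] -/
theorem checkChunk4_5 : checkChunk (upSetsC 4) ((upSetsC 4).image maskOf) arrTab4 2250 451 = true := by
  native_decide

/-- The table has `2701` entries (by evaluation). [this work] -/
theorem certTable4_size : certTable4.size = 2701 := by
  native_decide

/-- Unpacked check: the certificate of entry `j` passes. [this work] -/
theorem certOK_entry4 {j : ℕ} (hj : j < certTable4.size) :
    certOKfast2 16 (arrSetC (profOfCode (entry4 j).2.1)) (upSetsC 4) ((upSetsC 4).image maskOf) (setOfMask (entry4 j).1)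
      (tabOfConv (entry4 j).2.2 (arrSetC (profOfCode (entry4 j).2.1))) = true := by
  rw [certTable4_size] at hj
  have h : checkEntry4 (upSetsC 4) ((upSetsC 4).image maskOf) arrTab4 j = true := by
    rcases Nat.lt_or_ge j 450 with h0 | h0
    · exact checkEntry4_of_chunk checkChunk4_0 (Nat.zero_le j) (by omega)
    rcases Nat.lt_or_ge j 900 with h1 | h1
    · exact checkEntry4_of_chunk checkChunk4_1 h0 (by omega)
    rcases Nat.lt_or_ge j 1350 with h2 | h2
    · exact checkEntry4_of_chunk checkChunk4_2 h1 (by omega)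
    rcases Nat.lt_or_ge j 1800 with h3 | h3
    · exact checkEntry4_of_chunk checkChunk4_3 h2 (by omega)
    rcases Nat.lt_or_ge j 2250 with h4 | h4
    · exact checkEntry4_of_chunk checkChunk4_4 h3 (by omega)
    · exact checkEntry4_of_chunk checkChunk4_5 h4 (by omega)
  unfold checkEntry4 at h
  rw [Bool.and_eq_true, decide_eq_true_eq] at h
  obtain ⟨hlt, hc⟩ := h
  rwa [arrTab4_getD hlt] at hc

/-- ★★★ **THEOREM (one slot on four coordinates, the other two ARBITRARY).**  Let `A ⊆ {0,1}^4` be ANY up-set of the four front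
coordinates (all `168` of them: `x₀x₁ ∨ x₂x₃`, `(x₀∨x₁)(x₂∨x₃)`, thresholds, all graph up-sets on four vertices, …), `π` ANY front
profile, `b` ANY back profile on a cube of ANY dimension `d`, and `G, H` ANY nonnegative monotone functions on `{0,1}^{d+4}`.  Then
`0 ≤ c_{(π,b)}(1_A ∘ front, G, H)`.  Proof: the LP sandwich certificates (`certTable4`, one per `S₄`-orbit, exact integer check
`checkChunk4_0…5`), the relabelling transfer `tc_frontFn_nonneg_of_relab`, and the two-point reduction theorem. [this work] -/
theorem tc_front4_nonneg (π : Fin 4 → ℕ) {A : Finset (Pt 4)} (hA : IsUpperSet (A : Set (Pt 4))) {d : ℕ} (b : Fin d → ℕ)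
    {G H : Pt (d + 4) → ℝ} (hG : ∀ w, 0 ≤ G w) (hH : ∀ w, 0 ≤ H w) (hGm : Monotone G) (hHm : Monotone H) :
    0 ≤ tc (appendProf 4 π b) (frontFn 4 (setInd A)) G H := by
  by_cases hA0 : A = ∅
  · subst hA0; exact tc_frontFn_setInd_empty_nonneg π b hG hH hGm hHm
  by_cases hπ : ∀ i, π i ≤ 3
  · let π' : Fin 4 → Fin 4 := fun i => ⟨π i, by have := hπ i; omega⟩
    have eπ : (fun i => ((π' i : Fin 4) : ℕ)) = π := funext fun _ => rfl
    have hne : A.map (codeE 4).toEmbedding ≠ ∅ := by rwa [Ne, Finset.map_eq_empty]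
    obtain ⟨j, σ, hj, hFeq, hπeq⟩ := rep_of_coverWith coverAll4_true π' (map_mem_upSetsC hA) hne
    rw [eπ] at hπeq
    have hcert := certOK_entry4 hj
    set F₀ := setOfMask (entry4 j).1 with hF₀
    set π₀ := profOfCode (entry4 j).2.1 with hπ₀
    set A₀ : Finset (Pt 4) := F₀.map (codeE 4).symm.toEmbedding with hA₀def
    have hA₀ : A₀.map (codeE 4).toEmbedding = F₀ := by
      ext x
      rw [hA₀def, Finset.mem_map_equiv, Finset.mem_map_equiv, Equiv.symm_symm, Equiv.apply_symm_apply]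
    rw [← hA₀] at hcert
    obtain ⟨h0, h12⟩ := facts_of_certOKfast2 (by norm_num) (fun V hV W hW => inter_mem_upSetsC hV hW) hcert
    have hAA : A = A₀.map (relab σ).toEmbedding := by
      rw [← Finset.map_inj (f := (codeE 4).toEmbedding), map_relab_codeE, hA₀]
      exact hFeq
    exact tc_frontFn_nonneg_of_relab σ π₀ A₀ _ h0 h12 hπeq hAA b hG hH hGm hHm
  · obtain ⟨i, hi⟩ := not_forall.mp hπ
    rw [tc_frontFn_eq_zero_of_four_le π (by omega : 4 ≤ π i)]

/-- The same at an ARBITRARY profile `B` of the big cube `{0,1}^{d+4}` (every profile splits as `(π, b)`). [this work] -/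
theorem tc_front4_nonneg_all {d : ℕ} (B : Fin (d + 4) → ℕ) {A : Finset (Pt 4)} (hA : IsUpperSet (A : Set (Pt 4)))
    {G H : Pt (d + 4) → ℝ} (hG : ∀ w, 0 ≤ G w) (hH : ∀ w, 0 ≤ H w) (hGm : Monotone G) (hHm : Monotone H) :
    0 ≤ tc B (frontFn 4 (setInd A)) G H := by
  obtain ⟨π, b, rfl⟩ := exists_appendProf 4 B
  exact tc_front4_nonneg π hA b hG hH hGm hHm

/-- ★★ **Law level (Kahn's inequality `E₃ ≥ 0` for this class).**  For every product measure on `{0,1}^{d+4}` (coin weights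
`q ∈ [0,1]^{d+4}`), every up-set `A` of the four front coordinates and all nonnegative monotone `G, H`:
`E₃^{coin q}(1_A∘front, G, H) ≥ 0`. [this work] -/
theorem sahiE_three_coin_front4_nonneg {d : ℕ} {q : Fin (d + 4) → ℝ} (hq : ∀ i, 0 ≤ q i ∧ q i ≤ 1) {A : Finset (Pt 4)}
    (hA : IsUpperSet (A : Set (Pt 4))) {G H : Pt (d + 4) → ℝ} (hG : ∀ w, 0 ≤ G w) (hH : ∀ w, 0 ≤ H w) (hGm : Monotone G)
    (hHm : Monotone H) : 0 ≤ sahiE (coinWeight q) 3 ![frontFn 4 (setInd A), G, H] :=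
  sahiE_three_coin_nonneg_of_tc hq fun B => tc_front4_nonneg_all B hA hG hH hGm hHm

end K4

end Summit.CriticalPhenomena.PercolationContinuityZ3.Theorems.SahiThreeCopy
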